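import Summits.Ventures.Crystal3D.Theorems.StickyWulffConstantGenericWallFloorCapStartBarlow
import HarnessLib

/-!
# The deterministic zigzag INSIDE a moved Barlow plate: the walk's step at a plate ball, all four letter cases
# (crux `GenericWallFloor`, stmt-Ventures-19480, line `WallLedgerG`; exit criterion / flux count of the T-side port)

HONEST FRAMING. Venture `Summits/Ventures/Crystal3D` (cell `crystal3d-full`), helper `--supports` the crux `GenericWallFloor`
(stmt-Ventures-19480) of `route-Ventures-StickyWulffConstant`, registered line `WallLedgerG`, open stub `stub_twoSlabAdhesion`.
Rung credit only; F-C1 not moved; NOT the stub.  Sequel of `…CapStart` (abstract push/pop lemmas) and `…CapStartBarlow`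
(start states on `p ↦ L·barlowPos σ k i j + s₀`).

For a ball `t = L·barlowPos σ m i j + s₀` of layer `m` of a moved Barlow plate whose stacking sites within distance `1` of `t`
are occupied in a `1`-separated `X`, the stack walk's step from the CANONICAL state at `t` (frame of the bilayer BELOW `t`:
`L` if `σ (m−1) = 1`, the twin `G = twinFrame L (L e₃)` if `σ (m−1) = −1`) is determined by the letter `σ m` of the bilayer
ABOVE `t`:
* `walkStep_barlow_cc` (`σ(m−1) = 1, σ m = 1`): `t` is `L`-full — FULL step to `t + L v` (any direction slot `v`);
* `walkStep_barlow_ch` (`σ(m−1) = 1, σ m = −1`): `t` is an exact cap of `L` along the upper slot `v` with normal `L e₃` —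
  PUSH to `t + G q`, `q = bestCapper G (L e₃) z`, stack `[⟨G, q, L e₃⟩, ⟨L, v, 0⟩]`;
* `walkStep_barlow_hh` (`σ(m−1) = −1, σ m = −1`): `t` is `G`-full — FULL step to `t + G q` (stack kept);
* `walkStep_barlow_hc` (`σ(m−1) = −1, σ m = 1`): `t` is an exact cap of `G` along the `G`-positive slot `q` with normal
  `L e₃` = the top entry's normal — POP to `t + L v`, stack `[⟨L, v, 0⟩]`.
Every step lands on the plate ball one layer up (`L v` resp. `G q` is a layer step), so for a family of canonical start states
at heights `≤ H₀` whose layer step ends above `H₀` the exit criterion `walkRun_injOn_of_exit` applies.  Tools: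
`isOrientedCap_barlow_L` / `isOrientedCap_barlow_G` (the twin dozens of an h-layer ball in the two frames),
`basalMirror_of_inPlane`, `neg_add_two_smul_axis`.

WHAT THIS IS NOT: not the stub; no flux count; nothing about the filling above the plate; F-C1 not moved.
-/

noncomputable section

namespace Summit.Ventures.Crystal3D.Theorems

open Finset
open Literature.MathematicalPhysics.StatisticalMechanics
open scoped InnerProductSpace

variable {X : Finset (EuclideanSpace ℝ (Fin 3))}

/-! ### Small vector facts in the model frame -/

/-- The basal mirror fixes in-plane vectors. -/
theorem basalMirror_of_inPlane {w : EuclideanSpace ℝ (Fin 3)} (h : w 2 = 0) : basalMirror w = w := by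
  ext t
  rw [basalMirror_apply_coord]
  split_ifs with ht
  · subst ht; rw [h, neg_zero]
  · rfl

/-- The capper position in the model frame: `−w + (2 w₂) • e₃ = basalMirror (−w)`. -/
theorem neg_add_two_smul_axis (w : EuclideanSpace ℝ (Fin 3)) :
    -w + (2 * w 2) • EuclideanSpace.single (2 : Fin 3) (1 : ℝ) = basalMirror (-w) := by
  ext t
  rw [basalMirror_apply_coord]
  fin_cases t
  · simp
  · simp
  · simp; ring

/-- The capper position for the twin frame: `−basalMirror w + (2 (basalMirror w)₂) • e₃ = −w`. -/
theorem neg_basalMirror_add_two_smul_axis (w : EuclideanSpace ℝ (Fin 3)) :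
    -basalMirror w + (2 * basalMirror w 2) • EuclideanSpace.single (2 : Fin 3) (1 : ℝ) = -w := by
  ext t
  rw [PiLp.add_apply, PiLp.neg_apply, PiLp.smul_apply, basalMirror_apply_coord, basalMirror_apply_coord]
  fin_cases t
  · simp
  · simp
  · simp; ring

section Moved

variable (σ : ℤ → ℤ) (L : EuclideanSpace ℝ (Fin 3) ≃ₗᵢ[ℝ] EuclideanSpace ℝ (Fin 3)) (s₀ : EuclideanSpace ℝ (Fin 3))
  (m i j : ℤ)

/-- Local completeness around the ball `t = barlowPos σ m i j`: occupied stacking sites within distance `1` (moved). -/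
private theorem mem_of_site' {σ : ℤ → ℤ} {L : EuclideanSpace ℝ (Fin 3) ≃ₗᵢ[ℝ] EuclideanSpace ℝ (Fin 3)}
    {s₀ : EuclideanSpace ℝ (Fin 3)} {m i j : ℤ}
    (hX : ∀ q ∈ barlowStacking 1 (Real.sqrt (2 / 3)) σ, dist q (barlowPos 1 (Real.sqrt (2 / 3)) σ m i j) ≤ 1 → L q + s₀ ∈ X)
    {m' : ℤ} {d : EuclideanSpace ℝ (Fin 3)} (hd : ‖d‖ ≤ 1)
    (hmem : barlowPos 1 (Real.sqrt (2 / 3)) σ m i j + d ∈ barlowLayer 1 (Real.sqrt (2 / 3)) σ m') :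
    L (barlowPos 1 (Real.sqrt (2 / 3)) σ m i j) + s₀ + L d ∈ X := by
  have h := hX _ (barlowLayer_subset_stacking σ m' hmem) (by rw [dist_comm, dist_self_add_right]; exact hd)
  rw [map_add] at h
  convert h using 1
  abel

/-- **The `L`-twin dozen of an h-layer ball** (`σ(m−1) = 1`, `σ m = −1`): `t` is an exact cap of `L` oriented along any
upper slot `v` with normal `L e₃` (nine `L e₃`-non-positive `L`-slots in layers `m`, `m−1`; cappers in layer `m+1`). -/
theorem isOrientedCap_barlow_L (hX₁ : ∀ p ∈ X, ∀ q ∈ X, p ≠ q → 1 ≤ dist p q) {v : EuclideanSpace ℝ (Fin 3)}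
    (hlo : σ (m - 1) = 1) (hhi : σ m = -1)
    (hX : ∀ q ∈ barlowStacking 1 (Real.sqrt (2 / 3)) σ, dist q (barlowPos 1 (Real.sqrt (2 / 3)) σ m i j) ≤ 1 → L q + s₀ ∈ X)
    (hv2 : v 2 = Real.sqrt (2 / 3)) :
    IsOrientedCap X L (L (barlowPos 1 (Real.sqrt (2 / 3)) σ m i j) + s₀) v (L (EuclideanSpace.single (2 : Fin 3) (1 : ℝ))) := by
  have he : ‖EuclideanSpace.single (2 : Fin 3) (1 : ℝ)‖ = 1 := by rw [PiLp.norm_single, norm_one]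
  have hn : ‖L (EuclideanSpace.single (2 : Fin 3) (1 : ℝ))‖ = 1 := by rw [LinearIsometryEquiv.norm_map, he]
  have hrpos : 0 < Real.sqrt (2 / 3) := Real.sqrt_pos.2 (by norm_num)
  refine isOrientedCap_of_twinDozen hX₁ L hn (fun w hw => ?_) (by rw [inner_frame_axis, hv2]) (fun w hw h0 => ?_)
    (fun w hw h0 => ?_)
  · rw [inner_frame_axis]; exact slot_apply_two_cases hw
  · -- non-positive slots: in-plane (layer `m`) or lower (layer `m−1`)
    rw [inner_frame_axis] at h0
    have hnorm : ‖w‖ ≤ 1 := by rw [norm_eq_one_of_mem_fccSlots hw]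
    rcases slot_apply_two_cases hw with h | h | h
    · have hmem := barlow_nabla_add_slot_mem σ m i j hhi hw (by rw [h])
      rw [basalMirror_of_inPlane h] at hmem
      rcases hmem with h' | h'
      · exact mem_of_site' hX hnorm h'
      · exact mem_of_site' hX hnorm h'
    · rw [h] at h0; linarith
    · exact mem_of_site' hX hnorm (barlow_delta_sub_slot_mem σ m i j hlo hw h)
  · -- cappers: `t − L w + 2 w₂ • L e₃ = t + L (basalMirror (−w))`, a site of layer `m+1`
    rw [inner_frame_axis] at h0 ⊢
    have hw2 : w 2 = Real.sqrt (2 / 3) := by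
      rcases slot_apply_two_cases hw with h | h | h
      · rw [h] at h0; exact absurd h0 (lt_irrefl 0)
      · exact h
      · rw [h] at h0; linarith
    have hmem := barlow_nabla_add_slot_mem σ m i j hhi (neg_mem_fccSlots hw)
      (by rw [PiLp.neg_apply, hw2]; linarith)
    have hnorm : ‖basalMirror (-w)‖ ≤ 1 := by
      rw [LinearIsometryEquiv.norm_map, norm_neg, norm_eq_one_of_mem_fccSlots hw]
    have e : L (barlowPos 1 (Real.sqrt (2 / 3)) σ m i j) + s₀ - L w + (2 * w 2) • L (EuclideanSpace.single (2 : Fin 3) (1 : ℝ)) =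
        L (barlowPos 1 (Real.sqrt (2 / 3)) σ m i j) + s₀ + L (basalMirror (-w)) := by
      rw [← neg_add_two_smul_axis, map_add, map_neg, LinearIsometryEquiv.map_smul]; abel
    rw [e]
    rcases hmem with h' | h'
    · exact mem_of_site' hX hnorm h'
    · exact mem_of_site' hX hnorm h'

/-- **The `G`-twin dozen of an h-layer ball** (`σ(m−1) = −1`, `σ m = 1`), `G = twinFrame L (L e₃)`: `t` is an exact cap of
`G` oriented along any `G`-positive slot `q` (`q₂ = −√(2/3)`) with normal `L e₃`. -/
theorem isOrientedCap_barlow_G (hX₁ : ∀ p ∈ X, ∀ q ∈ X, p ≠ q → 1 ≤ dist p q) {q : EuclideanSpace ℝ (Fin 3)}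
    (hlo : σ (m - 1) = -1) (hhi : σ m = 1)
    (hX : ∀ q ∈ barlowStacking 1 (Real.sqrt (2 / 3)) σ, dist q (barlowPos 1 (Real.sqrt (2 / 3)) σ m i j) ≤ 1 → L q + s₀ ∈ X)
    (hq2 : q 2 = -Real.sqrt (2 / 3)) :
    IsOrientedCap X (twinFrame L (L (EuclideanSpace.single (2 : Fin 3) (1 : ℝ)))) (L (barlowPos 1 (Real.sqrt (2 / 3)) σ m i j) + s₀) q
      (L (EuclideanSpace.single (2 : Fin 3) (1 : ℝ))) := by
  have he : ‖EuclideanSpace.single (2 : Fin 3) (1 : ℝ)‖ = 1 := by rw [PiLp.norm_single, norm_one]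
  have hn : ‖L (EuclideanSpace.single (2 : Fin 3) (1 : ℝ))‖ = 1 := by rw [LinearIsometryEquiv.norm_map, he]
  have hrpos : 0 < Real.sqrt (2 / 3) := Real.sqrt_pos.2 (by norm_num)
  have hmenuL : ∀ w ∈ fccSlots, ⟪L w, L (EuclideanSpace.single (2 : Fin 3) (1 : ℝ))⟫_ℝ = 0 ∨
      ⟪L w, L (EuclideanSpace.single (2 : Fin 3) (1 : ℝ))⟫_ℝ = Real.sqrt (2 / 3) ∨
      ⟪L w, L (EuclideanSpace.single (2 : Fin 3) (1 : ℝ))⟫_ℝ = -Real.sqrt (2 / 3) := fun w hw => by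
    rw [inner_frame_axis]; exact slot_apply_two_cases hw
  have hmenuG := menu_reflect L (twinFrame L (L (EuclideanSpace.single (2 : Fin 3) (1 : ℝ)))) hn hmenuL
    (fun x => twinFrame_apply L hn x)
  refine isOrientedCap_of_twinDozen hX₁ _ hn hmenuG ?_ (fun w hw h0 => ?_) (fun w hw h0 => ?_)
  · rw [twinFrame_axis_apply, inner_frame_axis, basalMirror_apply_coord]; simp [hq2]
  · -- non-positive `G`-slots: in-plane (layer `m`) or `G`-lower = model-upper (layer `m−1`)
    rw [twinFrame_axis_apply, inner_frame_axis, basalMirror_apply_coord] at h0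
    simp only [if_true] at h0
    rw [twinFrame_axis_apply]
    have hnorm : ‖basalMirror w‖ ≤ 1 := by rw [LinearIsometryEquiv.norm_map, norm_eq_one_of_mem_fccSlots hw]
    rcases slot_apply_two_cases hw with h | h | h
    · have hmem := barlow_delta_add_slot_mem σ m i j hhi hw (by rw [h])
      rw [← basalMirror_of_inPlane h] at hmem
      rcases hmem with h' | h'
      · exact mem_of_site' hX hnorm h'
      · exact mem_of_site' hX hnorm h'
    · exact mem_of_site' hX hnorm (barlow_nabla_sub_slot_mem σ m i j hlo hw h)
    · rw [h] at h0; linarith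
  · -- cappers: `t − G w + 2⟪G w, n⟫ n = t + L (−w)`, and `−w` is an upper slot: layer `m+1`
    rw [twinFrame_axis_apply, inner_frame_axis] at h0 ⊢
    rw [basalMirror_apply_coord] at h0
    simp only [if_true] at h0
    have hw2 : w 2 = -Real.sqrt (2 / 3) := by
      rcases slot_apply_two_cases hw with h | h | h
      · rw [h] at h0; simp at h0
      · rw [h] at h0; linarith
      · exact h
    have hmem := barlow_delta_add_slot_mem σ m i j hhi (neg_mem_fccSlots hw) (by rw [PiLp.neg_apply, hw2, neg_neg]; exact hrpos.le)
    have hnorm : ‖-w‖ ≤ 1 := by rw [norm_neg, norm_eq_one_of_mem_fccSlots hw]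
    have e : L (barlowPos 1 (Real.sqrt (2 / 3)) σ m i j) + s₀ - L (basalMirror w) +
        (2 * basalMirror w 2) • L (EuclideanSpace.single (2 : Fin 3) (1 : ℝ)) =
        L (barlowPos 1 (Real.sqrt (2 / 3)) σ m i j) + s₀ + L (-w) := by
      rw [← neg_basalMirror_add_two_smul_axis, map_add, map_neg, LinearIsometryEquiv.map_smul]; abel
    rw [e]
    rcases hmem with h' | h'
    · exact mem_of_site' hX hnorm h'
    · exact mem_of_site' hX hnorm h'

/-- **Case `cc`** (`σ(m−1) = 1`, `σ m = 1`): the ball is `L`-full; the step from any 1-level state is FULL. -/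
theorem walkStep_barlow_cc {z v : EuclideanSpace ℝ (Fin 3)} (hlo : σ (m - 1) = 1) (hhi : σ m = 1)
    (hX : ∀ q ∈ barlowStacking 1 (Real.sqrt (2 / 3)) σ, dist q (barlowPos 1 (Real.sqrt (2 / 3)) σ m i j) ≤ 1 → L q + s₀ ∈ X)
    (rest : List WalkEntry) (nrm : EuclideanSpace ℝ (Fin 3)) :
    walkStep X z (L (barlowPos 1 (Real.sqrt (2 / 3)) σ m i j) + s₀, ⟨L, v, nrm⟩ :: rest) =
      some (L (barlowPos 1 (Real.sqrt (2 / 3)) σ m i j) + s₀ + L v, ⟨L, v, nrm⟩ :: rest) := by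
  refine walkStep_of_full X z _ ⟨L, v, nrm⟩ rest fun w hw => ?_
  have hnorm : ‖w‖ ≤ 1 := by rw [norm_eq_one_of_mem_fccSlots hw]
  rcases slot_apply_two_cases hw with h | h | h
  · rcases barlow_delta_add_slot_mem σ m i j hhi hw h.ge with h' | h'
    · exact mem_of_site' hX hnorm h'
    · exact mem_of_site' hX hnorm h'
  · rcases barlow_delta_add_slot_mem σ m i j hhi hw (by rw [h]; exact Real.sqrt_nonneg _) with h' | h'
    · exact mem_of_site' hX hnorm h'
    · exact mem_of_site' hX hnorm h'
  · exact mem_of_site' hX hnorm (barlow_delta_sub_slot_mem σ m i j hlo hw h)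

/-- **Case `ch`** (`σ(m−1) = 1`, `σ m = −1`): from the 1-level state along an upper slot `v` the step is the PUSH into the
twin frame `G = twinFrame L (L e₃)` along `q = bestCapper G (L e₃) z`. -/
theorem walkStep_barlow_ch (hX₁ : ∀ p ∈ X, ∀ q ∈ X, p ≠ q → 1 ≤ dist p q) {z v : EuclideanSpace ℝ (Fin 3)}
    (hlo : σ (m - 1) = 1) (hhi : σ m = -1)
    (hX : ∀ q ∈ barlowStacking 1 (Real.sqrt (2 / 3)) σ, dist q (barlowPos 1 (Real.sqrt (2 / 3)) σ m i j) ≤ 1 → L q + s₀ ∈ X)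
    (hv : v ∈ fccSlots) (hv2 : v 2 = Real.sqrt (2 / 3)) (nrm : EuclideanSpace ℝ (Fin 3)) :
    walkStep X z (L (barlowPos 1 (Real.sqrt (2 / 3)) σ m i j) + s₀, [⟨L, v, nrm⟩]) =
      some (L (barlowPos 1 (Real.sqrt (2 / 3)) σ m i j) + s₀ +
          twinFrame L (L (EuclideanSpace.single (2 : Fin 3) (1 : ℝ)))
            (bestCapper (twinFrame L (L (EuclideanSpace.single (2 : Fin 3) (1 : ℝ)))) (L (EuclideanSpace.single (2 : Fin 3) (1 : ℝ))) z),
        [⟨twinFrame L (L (EuclideanSpace.single (2 : Fin 3) (1 : ℝ))),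
          bestCapper (twinFrame L (L (EuclideanSpace.single (2 : Fin 3) (1 : ℝ)))) (L (EuclideanSpace.single (2 : Fin 3) (1 : ℝ))) z,
          L (EuclideanSpace.single (2 : Fin 3) (1 : ℝ))⟩, ⟨L, v, nrm⟩]) :=
  walkStep_push_of_orientedCap_nil hv (isOrientedCap_barlow_L σ L s₀ m i j hX₁ hlo hhi hX hv2)

/-- **Case `hh`** (`σ(m−1) = −1`, `σ m = −1`): the ball is `G`-full; the step from any state with top frame `G` is FULL. -/
theorem walkStep_barlow_hh {z q : EuclideanSpace ℝ (Fin 3)} (hlo : σ (m - 1) = -1) (hhi : σ m = -1)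
    (hX : ∀ q ∈ barlowStacking 1 (Real.sqrt (2 / 3)) σ, dist q (barlowPos 1 (Real.sqrt (2 / 3)) σ m i j) ≤ 1 → L q + s₀ ∈ X)
    (rest : List WalkEntry) (nrm : EuclideanSpace ℝ (Fin 3)) :
    walkStep X z (L (barlowPos 1 (Real.sqrt (2 / 3)) σ m i j) + s₀,
        ⟨twinFrame L (L (EuclideanSpace.single (2 : Fin 3) (1 : ℝ))), q, nrm⟩ :: rest) =
      some (L (barlowPos 1 (Real.sqrt (2 / 3)) σ m i j) + s₀ + twinFrame L (L (EuclideanSpace.single (2 : Fin 3) (1 : ℝ))) q,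
        ⟨twinFrame L (L (EuclideanSpace.single (2 : Fin 3) (1 : ℝ))), q, nrm⟩ :: rest) := by
  refine walkStep_of_full X z _ ⟨_, q, nrm⟩ rest fun w hw => ?_
  show L (barlowPos 1 (Real.sqrt (2 / 3)) σ m i j) + s₀ + twinFrame L (L (EuclideanSpace.single (2 : Fin 3) (1 : ℝ))) w ∈ X
  rw [twinFrame_axis_apply]
  have hnorm : ‖basalMirror w‖ ≤ 1 := by rw [LinearIsometryEquiv.norm_map, norm_eq_one_of_mem_fccSlots hw]
  rcases slot_apply_two_cases hw with h | h | h
  · rcases barlow_nabla_add_slot_mem σ m i j hhi hw h.le with h' | h'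
    · exact mem_of_site' hX hnorm h'
    · exact mem_of_site' hX hnorm h'
  · exact mem_of_site' hX hnorm (barlow_nabla_sub_slot_mem σ m i j hlo hw h)
  · rcases barlow_nabla_add_slot_mem σ m i j hhi hw (by rw [h]; exact neg_nonpos.2 (Real.sqrt_nonneg _)) with h' | h'
    · exact mem_of_site' hX hnorm h'
    · exact mem_of_site' hX hnorm h'

/-- **Case `hc`** (`σ(m−1) = −1`, `σ m = 1`): from a state with top entry `⟨G, q, L e₃⟩` (`q` a `G`-positive slot) over a level
`e′` the step is the POP to `t + e′.frame e′.dir`. -/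
theorem walkStep_barlow_hc (hX₁ : ∀ p ∈ X, ∀ q ∈ X, p ≠ q → 1 ≤ dist p q) {z q : EuclideanSpace ℝ (Fin 3)}
    (hlo : σ (m - 1) = -1) (hhi : σ m = 1)
    (hX : ∀ q ∈ barlowStacking 1 (Real.sqrt (2 / 3)) σ, dist q (barlowPos 1 (Real.sqrt (2 / 3)) σ m i j) ≤ 1 → L q + s₀ ∈ X)
    (hq : q ∈ fccSlots) (hq2 : q 2 = -Real.sqrt (2 / 3)) (e' : WalkEntry) (rest : List WalkEntry) :
    walkStep X z (L (barlowPos 1 (Real.sqrt (2 / 3)) σ m i j) + s₀,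
        ⟨twinFrame L (L (EuclideanSpace.single (2 : Fin 3) (1 : ℝ))), q, L (EuclideanSpace.single (2 : Fin 3) (1 : ℝ))⟩ ::
          e' :: rest) =
      some (L (barlowPos 1 (Real.sqrt (2 / 3)) σ m i j) + s₀ + e'.frame e'.dir, e' :: rest) :=
  walkStep_pop_of_orientedCap e' rest hq (isOrientedCap_barlow_G σ L s₀ m i j hX₁ hlo hhi hX hq2)

end Moved

end Summit.Ventures.Crystal3D.Theorems

end
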